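import Literature.MathematicalPhysics.QuantumFieldTheory.Balaban1983to89.T4ShellMeasure
import Literature.MathematicalPhysics.QuantumFieldTheory.Balaban1983to89.T4MarginalRenewal

/-!
# N21 (NE7c) · at the slot's own truncation, (M1) = (hazard constant) × (large-field odds)

R134 seat pub-ymgap-dag-n21-d (g8), node N21 = NE7c (single-run shell-weight bound, NOT PRINTED in [Bałaban 1983–89],
NOT proved), lane K3⁷ `SpineGivenEndpointR13SepCoPH` (stmt-QuantumFields-20544, `--kind proof --supports … --as helper`).
Part 11 of the comparison series; chain-independent (imports `T4ShellMeasure` + pub-balaban's `T4MarginalRenewal` for `odds_of_rel`) — it consumes the RELATIVE (hazard)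
form of (M1) that parts 7, 9, 10 produce (`measure_shell_iSup_le_of_condHazard`, `measure_shell_iSup_gibbs_le`, …) as a
hypothesis shape, for ANY tested variable `u` under ANY finite measure `ν`.

WHAT THIS FILE IS.  `T4ShellMeasure.SlotAntiConcentration` (:598) is read «under the run's positive measure at fixed
source with the slot's own indicator factor removed, or the fibre of the slot's pending operation»; the slot ledger then
charges the shell of slot `s` against the weight of the term in which `s` is SMALL, i.e. against the TRUNCATED measure
`ν|{u < θ}` (part 2 §5 `slotAntiConcentration_restrict_of_mass` is the passage, at the price of a mass lower bound).
This file observes that the hazard form makes that passage QUANTITATIVE AND SMALL.  If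
  (H) `ν{θ(1−ρ) ≤ u < θ} ≤ c · ν{θ(1−ρ) ≤ u}` (the shell is a `c`-fraction of the exceedance event; parts 7–10), and
  (LF) `ν{θ ≤ u} ≤ q · ν(univ)` (the LARGE-FIELD event of the slot has probability `≤ q < 1` under the un-truncated
       measure — the large-field smallness of [Bałaban, Large field renormalization I, CMP 122 (1989)] p.176 in
       caricature; NOT claimed here),
then, because the exceedance event is the shell PLUS the large-field event, `(1 − c)·ν(shell) ≤ c·ν{θ ≤ u}` (§1–§2:
`ν(shell) ≤ c∕(1−c) · ν{θ ≤ u}` — THE SHELL IS CARRIED BY THE LARGE-FIELD MASS), and relative to the truncated measure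
(§3) `ν(shell) ≤ (c∕(1−c))·(q∕(1−q)) · ν{u < θ}`: with `c = C·ρ ≤ ½`,
`T4ShellMeasure.SlotAntiConcentration (ν|{u < θ}) u θ ρ (2C · q∕(1−q))` — the (M1) constant of record is the hazard
constant TIMES THE LARGE-FIELD ODDS.  READING FOR THE WALL (hedged): on this road the shell weights of the slot ledger
inherit the large-field small factors `e^{−p₀(g_j)}` slot by slot, so their sum over the live window is of the same
species as node N20's large-field sums (NE7b), with the per-slot analytic input reduced to (H) = a one-sided slope
bound of the fibre action (parts 8–10).  Nothing of this is asserted for the (2.18) fibre law.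

HONEST FRAMING.  [textbook] measure arithmetic; 0 def, 0 sorry; (H) and (LF) are HYPOTHESES; NE7c NOT PRINTED ∕ NOT
proved; N21 NOT discharged; counts unmoved (typed 28∕28 · discharged 5∕27); count-neutral; one finite 𝕋⁴ at fixed ε —
nothing about ℝ⁴ ∕ OS ∕ mass gap ∕ Clay.
-/

open MeasureTheory Set
open scoped ENNReal NNReal

namespace Summit.QuantumFields.YangMills.Theorems.N21ShellFractionLargeFieldOdds

open Literature.MathematicalPhysics.QuantumFieldTheory.Balaban1983to89.T4ShellMeasure (SlotAntiConcentration)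
open Literature.MathematicalPhysics.QuantumFieldTheory.Balaban1983to89.T4MarginalRenewal (odds_of_rel)

/-! ## §1 The arithmetic: `S ≤ c(S + L)`, `c < 1` ⇒ `S ≤ c∕(1−c)·L` is the tree's
`T4MarginalRenewal.odds_of_rel` (pub-balaban, node U5c — the same «relative ⇒ odds» step), CITED BY NAME below. -/

/-! ## §2 The shell is carried by the large-field mass -/

section Shell

variable {Ω : Type*} [MeasurableSpace Ω] (ν : Measure Ω) [IsFiniteMeasure ν] (u : Ω → ℝ)

/-- **HAZARD FORM ⇒ SHELL ≤ ODDS × LARGE-FIELD MASS.**  If `ν{a ≤ u < b} ≤ c · ν{a ≤ u}` with `0 ≤ c < 1`, then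
`ν{a ≤ u < b} ≤ c∕(1−c) · ν{b ≤ u}`: the exceedance event splits into the shell and the large-field event `{b ≤ u}`.
No measurability needed (subadditivity). [textbook] -/
theorem measureReal_shell_le_of_hazard {a b c : ℝ} (hc0 : 0 ≤ c) (hc1 : c < 1)
    (h : ν {x | a ≤ u x ∧ u x < b} ≤ ENNReal.ofReal c * ν {x | a ≤ u x}) :
    ν.real {x | a ≤ u x ∧ u x < b} ≤ c / (1 - c) * ν.real {x | b ≤ u x} := by
  have hsub : {x | a ≤ u x} ⊆ {x | a ≤ u x ∧ u x < b} ∪ {x | b ≤ u x} := by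
    intro x hx
    by_cases hb : u x < b
    · exact Or.inl ⟨hx, hb⟩
    · exact Or.inr (not_lt.1 hb)
  have h1 : ν.real {x | a ≤ u x ∧ u x < b}
      ≤ c * (ν.real {x | a ≤ u x ∧ u x < b} + ν.real {x | b ≤ u x}) := by
    have h' := ENNReal.toReal_mono (ENNReal.mul_ne_top ENNReal.ofReal_ne_top (measure_ne_top ν _)) h
    rw [ENNReal.toReal_mul, ENNReal.toReal_ofReal hc0] at h'
    refine (le_of_eq (measureReal_def ν _)).trans (h'.trans (mul_le_mul_of_nonneg_left ?_ hc0))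
    rw [← measureReal_def]
    exact (measureReal_mono hsub).trans (measureReal_union_le _ _)
  exact odds_of_rel hc1 h1

/-- … in `ℝ≥0∞`: `ν{a ≤ u < b} ≤ ofReal(c∕(1−c)) · ν{b ≤ u}`. [textbook] -/
theorem measure_shell_le_of_hazard {a b c : ℝ} (hc0 : 0 ≤ c) (hc1 : c < 1)
    (h : ν {x | a ≤ u x ∧ u x < b} ≤ ENNReal.ofReal c * ν {x | a ≤ u x}) :
    ν {x | a ≤ u x ∧ u x < b} ≤ ENNReal.ofReal (c / (1 - c)) * ν {x | b ≤ u x} := by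
  have hr := measureReal_shell_le_of_hazard ν u hc0 hc1 h
  have hc' : 0 ≤ c / (1 - c) := div_nonneg hc0 (by linarith)
  rw [← ofReal_measureReal (μ := ν) (s := {x | a ≤ u x ∧ u x < b}),
    ← ofReal_measureReal (μ := ν) (s := {x | b ≤ u x}), ← ENNReal.ofReal_mul hc']
  exact ENNReal.ofReal_le_ofReal hr

/-! ## §3 Relative to the truncated measure: (M1) constant = hazard constant × large-field odds -/

/-- **THE SHELL FRACTION OF THE SMALL-FIELD TERM.**  Under (H) `ν(shell) ≤ c · ν(exceedance)` (`0 ≤ c < 1`) and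
(LF) `ν{θ ≤ u} ≤ q · ν(univ)` (`0 ≤ q < 1`):  `ν(shell) ≤ (c∕(1−c)) · (q∕(1−q)) · ν{u < θ}`. [textbook] -/
theorem measureReal_shell_le_odds_mul_smallField {θ ρ c q : ℝ} (hc0 : 0 ≤ c) (hc1 : c < 1) (hq0 : 0 ≤ q)
    (hq1 : q < 1)
    (hH : ν {x | θ * (1 - ρ) ≤ u x ∧ u x < θ} ≤ ENNReal.ofReal c * ν {x | θ * (1 - ρ) ≤ u x})
    (hLF : ν {x | θ ≤ u x} ≤ ENNReal.ofReal q * ν univ) :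
    ν.real {x | θ * (1 - ρ) ≤ u x ∧ u x < θ} ≤ c / (1 - c) * (q / (1 - q)) * ν.real {x | u x < θ} := by
  have h1 := measureReal_shell_le_of_hazard ν u hc0 hc1 hH
  -- (LF) in real form and the complement
  have hLF' : ν.real {x | θ ≤ u x} ≤ q * ν.real univ := by
    have h' := ENNReal.toReal_mono (ENNReal.mul_ne_top ENNReal.ofReal_ne_top (measure_ne_top ν _)) hLF
    rw [ENNReal.toReal_mul, ENNReal.toReal_ofReal hq0] at h'
    simpa only [measureReal_def] using h'
  have hcompl : ν.real univ ≤ ν.real {x | u x < θ} + ν.real {x | θ ≤ u x} := by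
    have hsub : (univ : Set Ω) ⊆ {x | u x < θ} ∪ {x | θ ≤ u x} := by
      intro x _
      by_cases hx : u x < θ
      · exact Or.inl hx
      · exact Or.inr (not_lt.1 hx)
    exact (measureReal_mono hsub).trans (measureReal_union_le _ _)
  -- ν{θ ≤ u} ≤ q/(1−q) · ν{u < θ}
  have h2 : ν.real {x | θ ≤ u x} ≤ q / (1 - q) * ν.real {x | u x < θ} := by
    refine odds_of_rel hq1 ?_
    nlinarith [measureReal_nonneg (μ := ν) (s := {x | u x < θ})]
  have hc' : 0 ≤ c / (1 - c) := div_nonneg hc0 (by linarith)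
  calc ν.real {x | θ * (1 - ρ) ≤ u x ∧ u x < θ} ≤ c / (1 - c) * ν.real {x | θ ≤ u x} := h1
    _ ≤ c / (1 - c) * (q / (1 - q) * ν.real {x | u x < θ}) := mul_le_mul_of_nonneg_left h2 hc'
    _ = c / (1 - c) * (q / (1 - q)) * ν.real {x | u x < θ} := by ring

/-- **(M1) AT THE SLOT'S OWN TRUNCATION = HAZARD CONSTANT × LARGE-FIELD ODDS.**  If the shell is a `C·ρ`-fraction of
the exceedance event (`C ≥ 0`, `ρ ≥ 0`, `C·ρ ≤ ½`; parts 7–10 give `C = H·θ`, `e·Λ·θ`, `2e·Λ·θ∕κ`) and the large-field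
event `{θ ≤ u}` has probability `≤ q < 1`, then
`T4ShellMeasure.SlotAntiConcentration (ν|{u < θ}) u θ ρ (2C · q∕(1−q))`. [textbook] -/
theorem slotAntiConcentration_restrict_of_hazard_largeField (hu : Measurable u) {θ ρ C q : ℝ} (hC : 0 ≤ C)
    (hρ : 0 ≤ ρ) (hsmall : C * ρ ≤ 1 / 2) (hq0 : 0 ≤ q) (hq1 : q < 1)
    (hH : ν {x | θ * (1 - ρ) ≤ u x ∧ u x < θ} ≤ ENNReal.ofReal (C * ρ) * ν {x | θ * (1 - ρ) ≤ u x})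
    (hLF : ν {x | θ ≤ u x} ≤ ENNReal.ofReal q * ν univ) :
    SlotAntiConcentration (ν.restrict {x | u x < θ}) u θ ρ (2 * C * (q / (1 - q))) := by
  unfold SlotAntiConcentration
  have hE : MeasurableSet {x | u x < θ} := measurableSet_lt hu measurable_const
  have hshell_sub : {x | θ * (1 - ρ) ≤ u x ∧ u x < θ} ⊆ {x | u x < θ} := fun x hx => hx.2
  rw [Measure.restrict_apply_univ, Measure.restrict_apply' hE, inter_eq_left.2 hshell_sub]
  have hCρ : 0 ≤ C * ρ := mul_nonneg hC hρ
  have hr := measureReal_shell_le_odds_mul_smallField ν u hCρ (by linarith) hq0 hq1 hH hLF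
  have hodds : 0 ≤ q / (1 - q) := div_nonneg hq0 (by linarith)
  have hr' : ν.real {x | θ * (1 - ρ) ≤ u x ∧ u x < θ} ≤ 2 * C * (q / (1 - q)) * ρ * ν.real {x | u x < θ} := by
    refine hr.trans (mul_le_mul_of_nonneg_right ?_ measureReal_nonneg)
    -- `Cρ ≤ ½ ⇒ Cρ∕(1 − Cρ) ≤ 2Cρ` (cf. the tree's `B9Eq342GradientRowAssembly.div_one_sub_le_two_mul`, not imported)
    have : C * ρ / (1 - C * ρ) ≤ 2 * (C * ρ) := by
      rw [div_le_iff₀ (by linarith)]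
      nlinarith
    calc C * ρ / (1 - C * ρ) * (q / (1 - q)) ≤ 2 * (C * ρ) * (q / (1 - q)) :=
          mul_le_mul_of_nonneg_right this hodds
      _ = 2 * C * (q / (1 - q)) * ρ := by ring
  have hD : 0 ≤ 2 * C * (q / (1 - q)) * ρ := by positivity
  rw [← ofReal_measureReal (μ := ν) (s := {x | θ * (1 - ρ) ≤ u x ∧ u x < θ}),
    ← ofReal_measureReal (μ := ν) (s := {x | u x < θ}), ← ENNReal.ofReal_mul hD]
  exact ENNReal.ofReal_le_ofReal hr'

end Shell

end Summit.QuantumFields.YangMills.Theorems.N21ShellFractionLargeFieldOdds
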